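import Literature.NumberTheory.Automorphic.StrongMultiplicityOneSphericalProofs
import Literature.NumberTheory.Automorphic.UnramifiedHeckeScalarsFlathProofs
import HarnessLib

/-!
# Global Jacquet–Langlands from its quaternionic parts and lang.S20 alone; strong multiplicity
one at the local spherical levels from lang.S20 alone

Topic `NumberTheory/Automorphic`; proof file closing the `GL_n` side of the decomposition of
`Literature.NumberTheory.Automorphic.jacquetLanglands_global` (lang.S22; Jacquet–Langlands, LNM 114, Thm. 14.4, 15.1,
16.1; Gelbart (1975), Thm. 10.5, 10.10). With the unramified-Hecke-scalar fact **SF** now a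
theorem (`Flath1979_heckeOperatorAt_ofLocal_eq_smul_holds`, `UnramifiedHeckeScalarsFlathProofs`)
the assemblies of `StrongMultiplicityOneSphericalProofs` lose that hypothesis:

* `Literature.NumberTheory.Automorphic.strong_multiplicity_one_gl_sphericalLevel_of_strong_multiplicity_one_gl''`:
  lang.S20 (`strong_multiplicity_one_gl`, for every automorphic measure) alone implies strong
  multiplicity one at the local spherical levels (`strong_multiplicity_one_gl_sphericalLevel`);
* `Literature.NumberTheory.Automorphic.jacquetLanglands_global_of_parts'''`: the three quaternionic parts of
  `JacquetLanglandsParts` — `jacquetLanglands_transfer_exists` (Gelbart Thm. 10.5 (i); JL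
  Thm. 14.4, 15.1), `strong_multiplicity_one_quaternionUnits` (Gelbart Thm. 10.5 (ii), 10.10),
  `jacquetLanglands_transfer_surjective` (JL Thm. 16.1; Gelbart Thm. 10.5 (ii)) — and lang.S20
  for `GL₂` imply `jacquetLanglands_global K D`.

So the remaining named facts under the vendored global Jacquet–Langlands correspondence are
exactly its three quaternionic parts and strong multiplicity one for `GL₂`. Also recorded:
unconditional uniqueness / level-independence of the Satake parameters of cuspidal
representations of `GL_n` (`HasSatakeParameterAt.sphericalLevelAt_unique`,
`HasSatakeParameterAt.eq_of_levels`). Theorems only.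

## References

* H. Jacquet, R. P. Langlands, *Automorphic forms on GL(2)*, LNM 114 (1970), Thm. 14.4, 15.1,
  16.1 [JacquetLanglands1970].
* S. Gelbart, *Automorphic forms on adele groups* (1975), Thm. 10.5, Thm. 10.10 [Gelbart1975].
-/

noncomputable section

open NumberField IsDedekindDomain MeasureTheory Literature.NumberTheory.Automorphic

namespace Literature.NumberTheory.Automorphic

section Assembly

variable {n : ℕ} {K : Type} [Field K] [NumberField K]

/-- **Strong multiplicity one at the local spherical levels from lang.S20 alone**: the tree's
`strong_multiplicity_one_gl` (for every automorphic measure) implies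
`strong_multiplicity_one_gl_sphericalLevel n K`, the scalar fact SF of
`strong_multiplicity_one_gl_sphericalLevel_of_strong_multiplicity_one_gl'` being the theorem
`Flath1979_heckeOperatorAt_ofLocal_eq_smul_holds` (Jacquet–Shalika (1981), Thm. 4.8 via
lang.S20; Getz–Hahn (2024), Thm. 11.7.2). [folklore] -/
theorem strong_multiplicity_one_gl_sphericalLevel_of_strong_multiplicity_one_gl''
    (hSMO : ∀ (μ : Measure (AdelicGroupData.gl n K).automorphicQuotient)
      [(AdelicGroupData.gl n K).IsAutomorphicMeasure μ],
      strong_multiplicity_one_gl (n := n) (K := K) (μ := μ)) :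
    strong_multiplicity_one_gl_sphericalLevel n K :=
  strong_multiplicity_one_gl_sphericalLevel_of_strong_multiplicity_one_gl' hSMO
    fun _ _ => Flath1979_heckeOperatorAt_ofLocal_eq_smul_holds

universe u

variable (K) (D : Type u) [Ring D] [Algebra K D] [IsQuaternionAlgebra K D]

/-- **Assembly of lang.S22, fourth form: quaternionic parts and lang.S20 only.** Existence of the
transfer (`jacquetLanglands_transfer_exists`: Gelbart (1975), Thm. 10.5 (i); JL Thm. 14.4,
15.1), rigidity (`strong_multiplicity_one_quaternionUnits`: Gelbart Thm. 10.5 (ii) with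
Thm. 10.10), surjectivity (`jacquetLanglands_transfer_surjective`: Gelbart Thm. 10.5 (ii); JL
Thm. 16.1) and lang.S20 (`strong_multiplicity_one_gl` for `GL₂`) imply the global
Jacquet–Langlands correspondence `jacquetLanglands_global` as vendored
(`jacquetLanglands_global_of_parts''` with SF := `Flath1979_heckeOperatorAt_ofLocal_eq_smul_holds`).
[cite: Gelbart1975, Thm. 10.5, Thm. 10.10] [cite: JacquetLanglands1970, Thm. 14.4, 15.1, 16.1] -/
theorem jacquetLanglands_global_of_parts'''
    (hT : jacquetLanglands_transfer_exists K D)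
    (hR : strong_multiplicity_one_quaternionUnits K D)
    (hS : jacquetLanglands_transfer_surjective K D)
    (hSMO : ∀ (μ : Measure (AdelicGroupData.gl 2 K).automorphicQuotient)
      [(AdelicGroupData.gl 2 K).IsAutomorphicMeasure μ],
      strong_multiplicity_one_gl (n := 2) (K := K) (μ := μ)) :
    jacquetLanglands_global K D :=
  jacquetLanglands_global_of_parts'' K D hT hR hS hSMO
    fun _ _ => Flath1979_heckeOperatorAt_ofLocal_eq_smul_holds

end Assembly

end Literature.NumberTheory.Automorphic

/-! ### Unconditional consequences for Satake parameters of cuspidal representations -/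

namespace Literature.NumberTheory.Automorphic

section Satake

variable {n : ℕ} {K : Type} [Field K] [NumberField K]
  {μ : Measure (AdelicGroupData.gl n K).automorphicQuotient}
  [(AdelicGroupData.gl n K).IsAutomorphicMeasure μ]

/-- **Satake parameters of a cuspidal representation at the local spherical level are unique**
(whatever the eigenvectors and uniformizers): `HasSatakeParameterAt.unique_sphericalLevelAt`
of `StrongMultiplicityOneSpherical` made unconditional by
`Flath1979_heckeOperatorAt_sphericalLevelAt_eq_smul_holds` (Cartier, Corvallis (1979), §IV.4;
Shimura, Thm. 3.21). [cite: CartierCorvallis1979, §IV.4] -/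
theorem HasSatakeParameterAt.sphericalLevelAt_unique (P : CuspidalAutomorphicRepGL n K μ)
    {v : HeightOneSpectrum (𝓞 K)} {ϖ ϖ' : (v.adicCompletion K)ˣ} {α β : Multiset ℂ}
    (hα : HasSatakeParameterAt P.1 (Literature.NumberTheory.Automorphic.sphericalLevelAt K n v) v ϖ α)
    (hβ : HasSatakeParameterAt P.1 (Literature.NumberTheory.Automorphic.sphericalLevelAt K n v) v ϖ' β) : α = β :=
  HasSatakeParameterAt.unique_sphericalLevelAt
    Flath1979_heckeOperatorAt_sphericalLevelAt_eq_smul_holds P hα hβ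

/-- **Satake parameters of a cuspidal representation do not depend on the level** `K(𝔫)`,
`v ∤ 𝔫`, at which they are read (nor on eigenvectors or uniformizers): the Hecke matrix
`t_{Π,v}` is an invariant of `Π` and `v` — `HasSatakeParameterAt.eq_of_ofLocal_eq_smul` of
`UnramifiedHeckeLevel` made unconditional by `Flath1979_heckeOperatorAt_ofLocal_eq_smul_holds`
(Cartier, Corvallis (1979), §IV; Borel–Jacquet, Corvallis (1979), §4.6; Arthur–Clozel (1989),
Ch. 3, §1). [cite: CartierCorvallis1979, §IV] -/
theorem HasSatakeParameterAt.eq_of_levels (P : CuspidalAutomorphicRepGL n K μ)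
    {𝔫 𝔫' : Ideal (𝓞 K)} (h𝔫 : 𝔫 ≠ 0) (h𝔫' : 𝔫' ≠ 0) {v : HeightOneSpectrum (𝓞 K)}
    (hv : ¬ v.asIdeal ∣ 𝔫) (hv' : ¬ v.asIdeal ∣ 𝔫') {ϖ ϖ' : (v.adicCompletion K)ˣ}
    {α β : Multiset ℂ} (hα : HasSatakeParameterAt P.1 (principalCongruenceLevel n K 𝔫) v ϖ α)
    (hβ : HasSatakeParameterAt P.1 (principalCongruenceLevel n K 𝔫') v ϖ' β) : α = β :=
  HasSatakeParameterAt.eq_of_ofLocal_eq_smul Flath1979_heckeOperatorAt_ofLocal_eq_smul_holds P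
    h𝔫 h𝔫' hv hv' hα hβ

end Satake

end Literature.NumberTheory.Automorphic
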